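import Summits.Parity.GeneralizedHardyLittlewood.Theorems.PrimeLevelFamEdgeMomentsBeyondDiagonalDiagDecorPrimePowPeel
import Summits.Parity.GeneralizedHardyLittlewood.Theorems.PrimeLevelFamEdgeMomentsBeyondDiagonalDiagDecorPrimeSq
import Summits.Parity.GeneralizedHardyLittlewood.Theorems.PrimeLevelFamEdgeMomentsBeyondDiagonalDiagPrimeSumLogPow
import HarnessLib

/-!
# Route `PrimeLevelFamEdge`, crux K_A `MomentsBeyondDiagonal` (stmt-Parity-20007), line «petersson_layers» v4, stub `stub_diag`:
# **the CROSS term of the `P₂²`-decoration: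
# `Σ_{p≤y}log²p·a_n(p)·Σ_{k′}a_{np}(k′)logᶜ(y/(pk′))P₂(k′) = 4·(1!c!/(c+2)!)·E_n·log^{c+2}y + O(D(n)(1+κ(n))(1+log y)^{c+1})`**

Brick of the `M₄ = τ(3P₂² − 2P₄)`-engine asked for by rung 2 of `stub_diag` (`…DiagRungTwoOfM4`): by the double peel
`…DiagDecorPrimePowPeel.sum_copTauW_mul_primeSq_sq_eq` the `P₂²`-decorated coprime Selberg sum is the `P₄`-peel
(`…DiagDecorPrimePowTwo.abs_coprimeSumPow_primePow_add_le_of_two_le`, `i = 3`: `−12E_n log^{c+2}y/((c+1)(c+2))`) plus the cross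
term treated here, whose inner sums are the `P₂`-decorated coprime sums of `…DiagDecorPrimeSq` at modulus `np` and scale `y/p`
(`≈ −2E_{np}logᶜ(y/p)`); with `a_n(p) = −2/(p+1)`, the transfer `(log p/(p+1))E_{np} = E_n·log p/(p−1)` and the Mertens
moment `…DiagPrimeSumLogPow` (`j = 1`, `a = c`) the cross term is `+4E_n log^{c+2}y/((c+1)(c+2))`, so that
`P₂² ↦ (−12 + 4) = −8` and `3·(−8) − 2·(−12) = 0`: the `M₄`-decorated coprime sums have NO term of order `log^{c+2}y`.

* `kappa_mul_prime_le` — `κ(np) ≤ κ(n) + 1` (`log p ≤ p − 1`);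
* `abs_coprimeSumPow_primeSq_add_le_of_two_le` — the `P₂`-engine of `…DiagDecorPrimeSq` in one uniform statement for `c ≥ 2`;
* `abs_primeSqCross_term_sub_le` — the termwise bound;
* `abs_primeSqCross_sub_le` — **the displayed cross-term asymptotic** (`c ≥ 2`).

Def-free; theorems only. Helper `--supports stmt-Parity-20007`; closes nothing; K_A, K_B and the Parity summit are NOT proved;
nothing about Landau–Siegel zeros.

## References
* E. Kowalski, P. Michel, J. VanderKam, J. reine angew. Math. 526 (2000), (23)–(28) pp. 13–15 and Prop. 5.1 p. 18.
  [cite: KowalskiMichelVanderKam2000, (23)–(28) — derivation (prime-power-log decorations of the Selberg coordinates)]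
* T. M. Apostol, *Introduction to Analytic Number Theory*, Springer 1976, Thm 4.9 (Mertens). [cite: Apostol1976, Thm 4.9 — derivation]
-/

noncomputable section

open scoped Real
open Finset ArithmeticFunction

namespace Summit.Parity.GeneralizedHardyLittlewood.Theorems.MomentsBeyondDiagonal.DiagKernel

open Literature.NumberTheory.LFunctions Literature.NumberTheory.LFunctions.KMV2000
open SelbergCoord (kappa)
open Summit.Parity.GeneralizedHardyLittlewood.Theorems.BeyondDiagonalBeatsQuarter.KernelFormXSq
  (copTauW copTauW_apply copTauW_apply_prime mainConst divWeight divWeight_nonneg mainConst_nonneg mainConst_le_divWeight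
    divWeight_prime_mul_le sum_prime_log_div_succ_le)

/-- `κ(np) ≤ κ(n) + 1` for `n ≥ 1` and a prime `p` (`κ(m) = Σ_{q∣m}log q/(q−1)`, `log p ≤ p − 1`). [folklore] -/
theorem kappa_mul_prime_le {n p : ℕ} (hn : n ≠ 0) (hp : p.Prime) : kappa (n * p) ≤ kappa n + 1 := by
  unfold kappa
  have hsub : (n * p).primeFactors ⊆ insert p n.primeFactors := by
    rw [Nat.primeFactors_mul hn hp.ne_zero, hp.primeFactors]
    intro q hq
    rcases Finset.mem_union.1 hq with h | h
    · exact Finset.mem_insert_of_mem h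
    · rw [Finset.mem_singleton.1 h]; exact Finset.mem_insert_self _ _
  have hnn : ∀ q ∈ insert p n.primeFactors, 0 ≤ Real.log q / ((q : ℝ) - 1) := by
    intro q hq
    have hq' : q.Prime := by
      rcases Finset.mem_insert.1 hq with rfl | h
      · exact hp
      · exact Nat.prime_of_mem_primeFactors h
    have hq2 : (2 : ℝ) ≤ q := by exact_mod_cast hq'.two_le
    exact div_nonneg (Real.log_nonneg (by linarith)) (by linarith)
  have hp2 : (2 : ℝ) ≤ p := by exact_mod_cast hp.two_le
  have hlp : Real.log p / ((p : ℝ) - 1) ≤ 1 := by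
    rw [div_le_one (by linarith)]
    exact Real.log_le_sub_one_of_pos (by linarith)
  calc ∑ q ∈ (n * p).primeFactors, Real.log q / ((q : ℝ) - 1)
      ≤ ∑ q ∈ insert p n.primeFactors, Real.log q / ((q : ℝ) - 1) :=
        Finset.sum_le_sum_of_subset_of_nonneg hsub fun q hq _ ↦ hnn q hq
    _ ≤ Real.log p / ((p : ℝ) - 1) + ∑ q ∈ n.primeFactors, Real.log q / ((q : ℝ) - 1) := by
        by_cases hpn : p ∈ n.primeFactors
        · rw [Finset.insert_eq_of_mem hpn]
          have : 0 ≤ Real.log p / ((p : ℝ) - 1) := hnn p (Finset.mem_insert_self _ _)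
          linarith
        · rw [Finset.sum_insert hpn]
    _ ≤ _ := by linarith

/-- **The `P₂`-engine of `…DiagDecorPrimeSq` in one uniform statement for all `c ≥ 2`.**
[cite: KowalskiMichelVanderKam2000, (23)–(28) and Prop. 5.1 — derivation (prime-square decoration, real variables)] -/
theorem abs_coprimeSumPow_primeSq_add_le_of_two_le {c : ℕ} (hc : 2 ≤ c) :
    ∃ C : ℝ, 0 < C ∧ ∀ n : ℕ, n ≠ 0 → ∀ y : ℝ, 1 ≤ y →
      |∑ k ∈ Icc 1 ⌊y⌋₊, copTauW n k * Real.log (y / k) ^ c * ∑ p ∈ k.primeFactors, Real.log p ^ 2 +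
          2 * mainConst n * Real.log y ^ c| ≤
        C * divWeight n * (1 + kappa n) * (1 + Real.log y) ^ (c - 1) := by
  rcases Nat.eq_or_lt_of_le hc with h | h
  · subst h
    obtain ⟨C, hC, h⟩ := abs_coprimeSum_primeSq_add_le
    exact ⟨C, hC, fun n hn y hy ↦ by rw [show 2 - 1 = 1 from rfl, pow_one]; exact h n hn y hy⟩
  · exact abs_coprimeSumPow_primeSq_add_le h

/-- Termwise bound for the cross term (`c ≥ 2` implicit in the hypothesis): with `C` the constant of
`abs_coprimeSumPow_primeSq_add_le_of_two_le`, for `p ≤ y`: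
`|[p prime]·log²p·a_n(p)·Σ_{k′}a_{np}(k′)logᶜ(y/(pk′))P₂(k′) − 4E_n·v(p)·log p·logᶜ(y/p)| ≤
[p prime, p∤n]·(log p/(p+1))·16C·D(n)(1+κ(n))(1+log y)^{c−1}log y`. [cite: KowalskiMichelVanderKam2000, (23)–(28) — derivation] -/
theorem abs_primeSqCross_term_sub_le {c : ℕ} {C : ℝ} (hC0 : 0 ≤ C)
    (hC : ∀ n : ℕ, n ≠ 0 → ∀ y : ℝ, 1 ≤ y →
      |∑ k ∈ Icc 1 ⌊y⌋₊, copTauW n k * Real.log (y / k) ^ c * ∑ p ∈ k.primeFactors, Real.log p ^ 2 +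
          2 * mainConst n * Real.log y ^ c| ≤
        C * divWeight n * (1 + kappa n) * (1 + Real.log y) ^ (c - 1))
    {n : ℕ} (hn : n ≠ 0) {y : ℝ} (hy : 1 ≤ y) {p : ℕ} (hp : p ∈ Icc 1 ⌊y⌋₊) :
    |(if p.Prime then Real.log p ^ 2 * copTauW n p *
          ∑ k ∈ Icc 1 (⌊y⌋₊ / p), copTauW (n * p) k *
            (Real.log (y / ((p * k : ℕ) : ℝ)) ^ c * ∑ q ∈ k.primeFactors, Real.log q ^ 2) else 0) -
        (4 * mainConst n) *
          ((if p.Prime ∧ ¬ p ∣ n then Real.log p / ((p : ℝ) - 1) else 0) *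
            (Real.log p ^ 1 * Real.log (y / p) ^ c))| ≤
      if p.Prime ∧ ¬ p ∣ n then
        Real.log p / ((p : ℝ) + 1) * (16 * C * divWeight n * (1 + kappa n) * (1 + Real.log y) ^ (c - 1) * Real.log y)
      else 0 := by
  obtain ⟨hp0, hpy, hyp1, hlp0, hlpy, hL0, hLy⟩ := prime_range_facts hy hp
  have hD := divWeight_nonneg n
  have hly : 0 ≤ Real.log y := Real.log_nonneg hy
  have hκ : 0 ≤ kappa n := by
    unfold kappa
    exact Finset.sum_nonneg fun q hq ↦ by
      have hq2 : (2 : ℝ) ≤ q := by exact_mod_cast (Nat.prime_of_mem_primeFactors hq).two_le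
      exact div_nonneg (Real.log_nonneg (by linarith)) (by linarith)
  by_cases hpr : p.Prime
  · by_cases hpn : p ∣ n
    · have h0 : copTauW n p = 0 := by rw [copTauW_apply_prime hpr, if_pos hpn]
      have hneg : ¬ (p.Prime ∧ ¬ p ∣ n) := fun h ↦ h.2 hpn
      rw [if_pos hpr, if_neg hneg, if_neg hneg, h0]
      simp
    · have hpos : p.Prime ∧ ¬ p ∣ n := ⟨hpr, hpn⟩
      -- reindex the inner sum at scale `y/p`
      have hre : ∑ k ∈ Icc 1 (⌊y⌋₊ / p), copTauW (n * p) k *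
            (Real.log (y / ((p * k : ℕ) : ℝ)) ^ c * ∑ q ∈ k.primeFactors, Real.log q ^ 2) =
          ∑ k ∈ Icc 1 ⌊y / p⌋₊, copTauW (n * p) k * Real.log (y / p / k) ^ c * ∑ q ∈ k.primeFactors, Real.log q ^ 2 := by
        rw [← Nat.floor_div_natCast]
        refine Finset.sum_congr rfl fun k _ ↦ ?_
        rw [Nat.cast_mul, div_div]
        ring
      rw [if_pos hpr, if_pos hpos, if_pos hpos, copTauW_apply_prime hpr, if_neg hpn, hre]
      have hnp : n * p ≠ 0 := mul_ne_zero hn hpr.ne_zero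
      have hin := hC (n * p) hnp (y / p) hyp1
      set S := ∑ k ∈ Icc 1 ⌊y / p⌋₊, copTauW (n * p) k * Real.log (y / p / k) ^ c *
        ∑ q ∈ k.primeFactors, Real.log q ^ 2 with hS
      set err := S + 2 * mainConst (n * p) * Real.log (y / p) ^ c with herr
      -- the size of the inner error
      have hDnp : divWeight (n * p) ≤ 2 * divWeight n := by
        rw [mul_comm]; exact divWeight_prime_mul_le hpr hn
      have hκnp : 1 + kappa (n * p) ≤ 2 * (1 + kappa n) := by
        have := kappa_mul_prime_le hn hpr; linarith
      have hκnp0 : 0 ≤ 1 + kappa (n * p) := by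
        have : 0 ≤ kappa (n * p) := by
          unfold kappa
          exact Finset.sum_nonneg fun q hq ↦ by
            have hq2 : (2 : ℝ) ≤ q := by exact_mod_cast (Nat.prime_of_mem_primeFactors hq).two_le
            exact div_nonneg (Real.log_nonneg (by linarith)) (by linarith)
        linarith
      have hpow : (1 + Real.log (y / p)) ^ (c - 1) ≤ (1 + Real.log y) ^ (c - 1) :=
        pow_le_pow_left₀ (by linarith) (by linarith) _
      have herr_le : |err| ≤ 4 * C * divWeight n * (1 + kappa n) * (1 + Real.log y) ^ (c - 1) := by
        calc |err| ≤ C * divWeight (n * p) * (1 + kappa (n * p)) * (1 + Real.log (y / p)) ^ (c - 1) := hin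
          _ ≤ C * (2 * divWeight n) * (2 * (1 + kappa n)) * (1 + Real.log y) ^ (c - 1) := by
              gcongr
          _ = 4 * C * divWeight n * (1 + kappa n) * (1 + Real.log y) ^ (c - 1) := by ring
      -- the main parts cancel by the prime weight transfer
      have hE := log_div_succ_mul_mainConst_mul hn hpr hpn
      have hp1 : (p : ℝ) + 1 ≠ 0 := by linarith
      have hSe : S = -2 * mainConst (n * p) * Real.log (y / p) ^ c + err := by rw [herr]; ring
      have hkey : Real.log p ^ 2 * (-2 * ((p : ℝ) + 1)⁻¹) * S -
          (4 * mainConst n) * (Real.log p / ((p : ℝ) - 1) * (Real.log p ^ 1 * Real.log (y / p) ^ c)) =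
          Real.log p ^ 2 * (-2 * ((p : ℝ) + 1)⁻¹) * err := by
        have hE' : mainConst n * (Real.log p / ((p : ℝ) - 1)) = Real.log p * ((p : ℝ) + 1)⁻¹ * mainConst (n * p) := by
          rw [← hE]; rw [div_eq_mul_inv]
        calc _ = Real.log p ^ 2 * (-2 * ((p : ℝ) + 1)⁻¹) * S -
              4 * (mainConst n * (Real.log p / ((p : ℝ) - 1))) * (Real.log p ^ 1 * Real.log (y / p) ^ c) := by ring
          _ = _ := by rw [hE', hSe]; ring
      rw [hkey, abs_mul, abs_mul, abs_of_nonneg (pow_nonneg hlp0 2)]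
      have habs2 : |(-2 : ℝ) * ((p : ℝ) + 1)⁻¹| = 2 * ((p : ℝ) + 1)⁻¹ := by
        rw [abs_mul, abs_inv, abs_of_pos (by linarith : (0 : ℝ) < (p : ℝ) + 1)]
        norm_num
      rw [habs2]
      calc Real.log p ^ 2 * (2 * ((p : ℝ) + 1)⁻¹) * |err|
          ≤ Real.log p ^ 2 * (2 * ((p : ℝ) + 1)⁻¹) *
              (4 * C * divWeight n * (1 + kappa n) * (1 + Real.log y) ^ (c - 1)) :=
            mul_le_mul_of_nonneg_left herr_le (by positivity)
        _ = Real.log p / ((p : ℝ) + 1) *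
              (16 * C * divWeight n * (1 + kappa n) * (1 + Real.log y) ^ (c - 1) * (Real.log p / 2)) := by
            rw [div_eq_mul_inv]; ring
        _ ≤ Real.log p / ((p : ℝ) + 1) *
              (16 * C * divWeight n * (1 + kappa n) * (1 + Real.log y) ^ (c - 1) * Real.log y) := by
            have : Real.log p / 2 ≤ Real.log y := by linarith
            gcongr
  · have hneg : ¬ (p.Prime ∧ ¬ p ∣ n) := fun h ↦ hpr h.1
    rw [if_neg hpr, if_neg hneg, if_neg hneg]
    simp

/-- **The cross term of the `P₂²`-decoration** (`c ≥ 2`): there is `C` with, for all `n ≥ 1`, `y ≥ 1`,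
`|Σ_{p≤y prime}log²p·a_n(p)·Σ_{k′≤⌊y⌋/p}a_{np}(k′)logᶜ(y/(pk′))P₂(k′) − 4·(1!c!/(c+2)!)·E_n·log^{c+2}y| ≤ C·D(n)(1+κ(n))(1+log y)^{c+1}`.
[cite: KowalskiMichelVanderKam2000, (23)–(28) and Prop. 5.1 — derivation (prime-square-squared decoration, real variables)] -/
theorem abs_primeSqCross_sub_le {c : ℕ} (hc : 2 ≤ c) :
    ∃ C : ℝ, 0 < C ∧ ∀ n : ℕ, n ≠ 0 → ∀ y : ℝ, 1 ≤ y →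
      |∑ p ∈ (Icc 1 ⌊y⌋₊).filter Nat.Prime, Real.log p ^ 2 * copTauW n p *
          ∑ k ∈ Icc 1 (⌊y⌋₊ / p), copTauW (n * p) k *
            (Real.log (y / ((p * k : ℕ) : ℝ)) ^ c * ∑ q ∈ k.primeFactors, Real.log q ^ 2) -
          4 * ((Nat.factorial 1 : ℝ) * c.factorial / (c + 1 + 1).factorial) * mainConst n * Real.log y ^ (c + 1 + 1)| ≤
        C * divWeight n * (1 + kappa n) * (1 + Real.log y) ^ (c + 1) := by
  obtain ⟨C, hC0, hC⟩ := abs_coprimeSumPow_primeSq_add_le_of_two_le hc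
  obtain ⟨C_E, hC_E, hE⟩ := mainConst_le_divWeight
  refine ⟨32 * C + 152 * C_E, by positivity, fun n hn y hy ↦ ?_⟩
  have hy0 : 0 < y := by linarith
  have hly : 0 ≤ Real.log y := Real.log_nonneg hy
  have hκ : 0 ≤ kappa n := by
    unfold kappa
    exact Finset.sum_nonneg fun p hp ↦ by
      have hp2 : (2 : ℝ) ≤ p := by exact_mod_cast (Nat.prime_of_mem_primeFactors hp).two_le
      exact div_nonneg (Real.log_nonneg (by linarith)) (by linarith)
  have hD := divWeight_nonneg n
  have hE0 := mainConst_nonneg n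
  have hEn := hE n hn
  have hl4 : Real.log 4 ≤ 2 := by
    have := Real.log_two_lt_d9
    have h4 : Real.log 4 = 2 * Real.log 2 := by
      rw [show (4 : ℝ) = 2 ^ 2 by norm_num, Real.log_pow]; ring
    rw [h4]; linarith
  have hl40 : 0 ≤ Real.log 4 := Real.log_nonneg (by norm_num)
  set N := ⌊y⌋₊ with hN
  have hN1 : 1 ≤ N := by rw [hN]; exact Nat.one_le_floor_iff _ |>.2 hy
  have hlogN : Real.log N ≤ Real.log y :=
    Real.log_le_log (by exact_mod_cast hN1) (Nat.floor_le hy0.le)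
  have hlogN0 : 0 ≤ Real.log N := Real.log_natCast_nonneg N
  rw [Finset.sum_filter]
  obtain ⟨T, hT⟩ : ∃ T : ℕ → ℝ, ∀ p, T p = if p.Prime then Real.log p ^ 2 * copTauW n p *
      ∑ k ∈ Icc 1 (N / p), copTauW (n * p) k *
        (Real.log (y / ((p * k : ℕ) : ℝ)) ^ c * ∑ q ∈ k.primeFactors, Real.log q ^ 2) else 0 :=
    ⟨_, fun _ ↦ rfl⟩
  obtain ⟨v, hv⟩ : ∃ v : ℕ → ℝ, ∀ p, v p = if p.Prime ∧ ¬ p ∣ n then Real.log p / ((p : ℝ) - 1) else 0 :=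
    ⟨_, fun _ ↦ rfl⟩
  simp only [← hT]
  set K : ℝ := 16 * C * divWeight n * (1 + kappa n) * (1 + Real.log y) ^ (c - 1) * Real.log y with hK
  have hK0 : 0 ≤ K := by positivity
  set k : ℝ := 4 * mainConst n with hk
  set q : ℝ := (Nat.factorial 1 : ℝ) * c.factorial / (c + 1 + 1).factorial with hq
  have hmain := abs_sum_primeWeight_coprime_logPow_mul_log_pow_sub_le hn hy 1 c
  simp only [← hv] at hmain
  rw [← hq] at hmain
  have hterm : ∀ p ∈ Icc 1 N, |T p - k * (v p * (Real.log p ^ 1 * Real.log (y / p) ^ c))| ≤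
      if p.Prime ∧ ¬ p ∣ n then Real.log p / ((p : ℝ) + 1) * K else 0 := by
    intro p hp
    rw [hT p, hv p]
    exact abs_primeSqCross_term_sub_le hC0.le hC hn hy hp
  have hsplit : ∑ p ∈ Icc 1 N, T p - 4 * q * mainConst n * Real.log y ^ (c + 1 + 1) =
      ∑ p ∈ Icc 1 N, (T p - k * (v p * (Real.log p ^ 1 * Real.log (y / p) ^ c))) +
        k * (∑ p ∈ Icc 1 N, v p * (Real.log p ^ 1 * Real.log (y / p) ^ c) - q * Real.log y ^ (c + 1 + 1)) := by
    rw [Finset.sum_sub_distrib, ← Finset.mul_sum, hk]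
    ring
  rw [hsplit]
  have hA : |∑ p ∈ Icc 1 N, (T p - k * (v p * (Real.log p ^ 1 * Real.log (y / p) ^ c)))| ≤
      K * (Real.log N + Real.log 4) := by
    calc _ ≤ ∑ p ∈ Icc 1 N, |T p - k * (v p * (Real.log p ^ 1 * Real.log (y / p) ^ c))| :=
          Finset.abs_sum_le_sum_abs _ _
      _ ≤ ∑ p ∈ Icc 1 N, (if p.Prime ∧ ¬ p ∣ n then Real.log p / ((p : ℝ) + 1) * K else 0) :=
          Finset.sum_le_sum hterm
      _ ≤ K * (Real.log N + Real.log 4) := sum_prime_log_div_succ_le n N hK0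
  have hB : |k * (∑ p ∈ Icc 1 N, v p * (Real.log p ^ 1 * Real.log (y / p) ^ c) - q * Real.log y ^ (c + 1 + 1))| ≤
      4 * mainConst n * (2 ^ 1 * (19 + kappa n) * (1 + Real.log y) ^ (c + 1)) := by
    rw [abs_mul]
    have hkabs : |k| = 4 * mainConst n := by rw [hk, abs_mul, abs_of_nonneg hE0]; norm_num
    rw [hkabs]
    exact mul_le_mul_of_nonneg_left hmain (by positivity)
  have hX0 : 0 ≤ (1 + Real.log y) ^ (c + 1) := by positivity
  have hpow : (1 + Real.log y) ^ (c - 1) * Real.log y * (Real.log N + Real.log 4) ≤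
      2 * (1 + Real.log y) ^ (c + 1) := by
    have e : c + 1 = (c - 1) + 2 := by omega
    have h1 : Real.log y ≤ 1 + Real.log y := by linarith
    have h2 : Real.log N + Real.log 4 ≤ 2 * (1 + Real.log y) := by linarith
    have hA : Real.log y * (Real.log N + Real.log 4) ≤ (1 + Real.log y) * (2 * (1 + Real.log y)) :=
      mul_le_mul h1 h2 (add_nonneg hlogN0 hl40) (by positivity)
    calc (1 + Real.log y) ^ (c - 1) * Real.log y * (Real.log N + Real.log 4)
        = (1 + Real.log y) ^ (c - 1) * (Real.log y * (Real.log N + Real.log 4)) := by ring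
      _ ≤ (1 + Real.log y) ^ (c - 1) * ((1 + Real.log y) * (2 * (1 + Real.log y))) :=
          mul_le_mul_of_nonneg_left hA (by positivity)
      _ = 2 * (1 + Real.log y) ^ (c + 1) := by rw [e, pow_add]; ring
  have hfirst : K * (Real.log N + Real.log 4) ≤ 32 * C * divWeight n * (1 + kappa n) * (1 + Real.log y) ^ (c + 1) := by
    calc K * (Real.log N + Real.log 4)
        = 16 * C * divWeight n * (1 + kappa n) * ((1 + Real.log y) ^ (c - 1) * Real.log y * (Real.log N + Real.log 4)) := by
          rw [hK]; ring
      _ ≤ 16 * C * divWeight n * (1 + kappa n) * (2 * (1 + Real.log y) ^ (c + 1)) :=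
          mul_le_mul_of_nonneg_left hpow (by positivity)
      _ = 32 * C * divWeight n * (1 + kappa n) * (1 + Real.log y) ^ (c + 1) := by ring
  have hsecond : 4 * mainConst n * (2 ^ 1 * (19 + kappa n) * (1 + Real.log y) ^ (c + 1)) ≤
      152 * C_E * divWeight n * (1 + kappa n) * (1 + Real.log y) ^ (c + 1) := by
    have j2 : mainConst n * (19 + kappa n) ≤ (C_E * divWeight n) * (19 * (1 + kappa n)) :=
      mul_le_mul hEn (by linarith) (by positivity) (by positivity)
    calc 4 * mainConst n * (2 ^ 1 * (19 + kappa n) * (1 + Real.log y) ^ (c + 1))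
        = 8 * (mainConst n * (19 + kappa n)) * (1 + Real.log y) ^ (c + 1) := by ring
      _ ≤ 8 * ((C_E * divWeight n) * (19 * (1 + kappa n))) * (1 + Real.log y) ^ (c + 1) := by
          apply mul_le_mul_of_nonneg_right _ hX0
          exact mul_le_mul_of_nonneg_left j2 (by norm_num)
      _ = 152 * C_E * divWeight n * (1 + kappa n) * (1 + Real.log y) ^ (c + 1) := by ring
  calc _ ≤ |∑ p ∈ Icc 1 N, (T p - k * (v p * (Real.log p ^ 1 * Real.log (y / p) ^ c)))| +
        |k * (∑ p ∈ Icc 1 N, v p * (Real.log p ^ 1 * Real.log (y / p) ^ c) - q * Real.log y ^ (c + 1 + 1))| :=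
        abs_add_le _ _
    _ ≤ K * (Real.log N + Real.log 4) + 4 * mainConst n * (2 ^ 1 * (19 + kappa n) * (1 + Real.log y) ^ (c + 1)) :=
        add_le_add hA hB
    _ ≤ 32 * C * divWeight n * (1 + kappa n) * (1 + Real.log y) ^ (c + 1) +
        152 * C_E * divWeight n * (1 + kappa n) * (1 + Real.log y) ^ (c + 1) := add_le_add hfirst hsecond
    _ = (32 * C + 152 * C_E) * divWeight n * (1 + kappa n) * (1 + Real.log y) ^ (c + 1) := by ring

end Summit.Parity.GeneralizedHardyLittlewood.Theorems.MomentsBeyondDiagonal.DiagKernel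

end
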